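import Literature.NumberTheory.EllipticCurves.KrizLi2019.EisensteinHeegnerLog
import Mathlib.Analysis.Normed.Group.Ultra
import HarnessLib

/-!
# O11 at an additive Eisenstein prime, ROUTE U — T-U3′: the ELEMENTARY (mod `p²`) certificate for
# "`B_{1,χ}` is a `p`-adic unit" (the Bernoulli hypothesis (H-B) of Theorem U / Kriz–Li Thm. 1.20)

HONEST FRAMING (cell `bsd-cm`, run/shared/lean/pub/bsd-cm/, verbatim): the programme isolates, for
CM elliptic curves over `ℚ` of analytic rank `≤ 1`, classes on which the FULL BSD formula is
reduced — strictly by PUBLISHED theorems entering as named-fact binders — to ONE local problem at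
ONE prime, and then TYPES that residual problem. Seat `bsd-cm-ram` (generation 3; TARGET.md §2
T-U3′, planner's explicit certificate form of 2026-08-25T11:37Z). THEOREMS ONLY (no definition,
no named fact; nothing asserted about any curve or character; nothing booked on numerics).

## What is here

The Bernoulli hypothesis of `KrizLi2019.thm120_padicLogHeegner_unit_of_bernoulli` reads
`¬ ‖B_{1,χ₁} · B_{1,χ₂}‖_p ≤ p⁻¹` for the PRIMITIVE characters inducing `χ₁ = ψ₀⁻¹ε_K`,
`χ₂ = ψ₀ω⁻¹` (`KrizLi2019.bernoulliOnePrim`). For ROUTE U (`p = 7`, `E_D = 49a1^{(D)}`):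
`χ₁ ~ ω⁴χ_D` (conductor `7|D|`), `χ₂ ~ ωχ_Dχ_{d''}` (conductor `7|Dd''|`) — both of conductor
EXACTLY divisible by `p`, of the shape "power of the Teichmüller character × a `ℤ`-valued
character". This file proves the kernel form of the planner's mod-`p²` certificate
(TARGET §2 T-U3′: "`‖B_{1,ω^aχ_q}‖₇ = 1 ⟺ S_a := Σ_{m ≤ f, 7 ∤ m} χ_q(m) m^{7a+1}` has
`S_a mod 49 ∈ {7, …, 42}`"), in three generic pieces:

* `norm_generalizedBernoulli_one_eq_one_of_cert` — for ANY non-trivial `χ` mod `n` with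
  `ord_p n = 1` and values in `ℚ_p`: if `χ(j) ≡ c(j) · j^e (mod p²)` for an integer-valued `c`
  and some exponent `e` (for `χ = ω^a θ`: `c = θ`, `e = pa`, by
  `KrizLi2019.IsTeichmullerCharacter.norm_pow_sub_pow_le`), and the INTEGER
  `S = Σ_{j mod n} c(j) j^{e+1}` (representatives `0 ≤ j < n`) satisfies `p ∣ S`, `p² ∤ S`, then
  `‖B_{1,χ}‖_p = 1`. Proof: `B_{1,χ} = n⁻¹ Σ χ(j) j` (`KrizLi2019.generalizedBernoulli_one_eq_sum_div`),
  `‖Σ χ(j) j − S‖ ≤ p⁻²` (ultrametric), `‖S‖ = p⁻¹`, `‖n⁻¹‖ = p`.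
* `generalizedBernoulli_congr_level` / `bernoulliOnePrim_changeLevel_eq` /
  `bernoulliOnePrim_eq_of_isPrimitive` — `bernoulliOnePrim (changeLevel _ θ) = B_{1,θ}` for `θ`
  PRIMITIVE (the fact's characters are imprimitive lifts; Mathlib's `primitiveCharacter` API).
* `not_norm_mul_le_inv_of_norm_eq_one` — two units give the fact's hypothesis
  `¬ ‖B₁ · B₂‖ ≤ p⁻¹`; assembled as `bernoulli_hypothesis_of_certs`.

What this file does NOT do: construct `ω`, `χ_D`, `ε_K` for any `D` (T-U4, per-member
certificates, optional), evaluate any sum, or assert (H-B) for any `D` — the 103 two-engine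
instances of memo §2/A7 stay NUMERICS (cell rule). References: [KrizLi2019] §1.5 (1) (p. 7),
Thm. 1.20 (pp. 7–8), §8 (35); [Washington1997] §5.1 (Teichmüller character), Thm. 4.2
(`B_{1,χ} = f⁻¹ Σ χ(a) a`); [Gouvea1993PadicNumbers] §5.8.
-/

noncomputable section

open scoped Classical
open Literature.NumberTheory.LFunctions Literature.NumberTheory.EllipticCurves.KrizLi2019

namespace Summit.BirchSwinnertonDyer.Rank1Residual.X12.O11.RouteU

variable {p : ℕ} [Fact p.Prime]

/-! ## §1 Generalised Bernoulli numbers depend only on (level, values) -/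

/-- **Transport of `B_{k,χ}` along an equality of levels**: characters of (propositionally) equal
levels with the same values at the integers coprime to the level have the same generalised
Bernoulli numbers. (Bookkeeping for Mathlib's `primitiveCharacter`, which lives at the level
`χ.conductor`.) [folklore] -/
theorem generalizedBernoulli_congr_level {R : Type*} [CommRing R] [Algebra ℚ R] {m₁ m₂ : ℕ}
    [NeZero m₁] [NeZero m₂] (h : m₁ = m₂) (k : ℕ) (χ₁ : DirichletCharacter R m₁)
    (χ₂ : DirichletCharacter R m₂) (hval : ∀ a : ℤ, IsCoprime a m₁ → χ₁ a = χ₂ a) :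
    generalizedBernoulli k χ₁ = generalizedBernoulli k χ₂ := by
  subst h
  have hχ : χ₁ = χ₂ := by
    refine MulChar.ext fun u => ?_
    have hu : ((((u : ZMod m₁).val : ℕ) : ℤ) : ZMod m₁) = (u : ZMod m₁) := by
      rw [Int.cast_natCast, ZMod.natCast_zmod_val]
    have hcop : IsCoprime (((u : ZMod m₁).val : ℕ) : ℤ) (m₁ : ℤ) :=
      Nat.isCoprime_iff_coprime.mpr (ZMod.val_coe_unit_coprime u)
    have := hval _ hcop
    rwa [hu] at this
  rw [hχ]

/-- **`bernoulliOnePrim` of an imprimitive lift**: for `θ` PRIMITIVE of level `m ∣ n`,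
`bernoulliOnePrim (changeLevel θ) = B_{1,θ}` (the primitive character inducing `changeLevel θ`
is `θ`: Mathlib `conductor_changeLevel`, `primitiveCharacter_changeLevel_apply`,
`primitiveCharacter_apply_of_isCoprime`). [cite: KrizLi2019, §2 (p. 11, "`ψ₁ψ₂` denote the unique primitive Dirichlet character …")] -/
theorem bernoulliOnePrim_changeLevel_eq {m n : ℕ} [NeZero m] [NeZero n]
    (θ : DirichletCharacter ℚ_[p] m) (hθ : θ.IsPrimitive) (hm : m ∣ n) :
    bernoulliOnePrim (DirichletCharacter.changeLevel hm θ) = generalizedBernoulli 1 θ := by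
  rw [bernoulliOnePrim_def]
  have hc : (DirichletCharacter.changeLevel hm θ).conductor = m :=
    (DirichletCharacter.conductor_changeLevel θ hm).trans hθ
  haveI : NeZero (DirichletCharacter.changeLevel hm θ).conductor :=
    ⟨DirichletCharacter.conductor_ne_zero _⟩
  refine generalizedBernoulli_congr_level hc 1 _ θ fun a ha => ?_
  rw [DirichletCharacter.primitiveCharacter_changeLevel_apply hm θ a]
  rw [hc] at ha
  exact DirichletCharacter.primitiveCharacter_apply_of_isCoprime θ ha

/-- **`bernoulliOnePrim θ = B_{1,θ}` for `θ` primitive.** [cite: KrizLi2019, §1.5 display (1) (p. 7)] -/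
theorem bernoulliOnePrim_eq_of_isPrimitive {m : ℕ} [NeZero m] (θ : DirichletCharacter ℚ_[p] m)
    (hθ : θ.IsPrimitive) : bernoulliOnePrim θ = generalizedBernoulli 1 θ := by
  have h := bernoulliOnePrim_changeLevel_eq θ hθ (dvd_refl m)
  rwa [DirichletCharacter.changeLevel_self] at h

/-! ## §2 The mod-`p²` certificate for `‖B_{1,χ}‖_p = 1` at a level exactly divisible by `p` -/

/-- `‖(z : ℚ_p)‖ = p⁻¹` for an integer `z` with `p ∣ z`, `p² ∤ z`. [folklore] -/
theorem norm_intCast_eq_inv_of_dvd_of_not_sq_dvd {z : ℤ} (h1 : (p : ℤ) ∣ z)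
    (h2 : ¬ (p : ℤ) ^ 2 ∣ z) : ‖(z : ℚ_[p])‖ = (p : ℝ)⁻¹ := by
  have hz0 : z ≠ 0 := by rintro rfl; exact h2 (dvd_zero _)
  have hv : padicValInt p z = 1 := by
    have h1' : 1 ≤ padicValInt p z := by
      rcases (padicValInt_dvd_iff 1 z).mp (by simpa using h1) with h | h
      · exact absurd h hz0
      · exact h
    have h2' : ¬ 2 ≤ padicValInt p z := fun h =>
      h2 ((padicValInt_dvd_iff 2 z).mpr (Or.inr h))
    omega
  have hz0' : (z : ℚ_[p]) ≠ 0 := by exact_mod_cast hz0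
  rw [Padic.norm_eq_zpow_neg_valuation hz0', Padic.valuation_intCast, hv]
  simp

/-- `‖(n : ℚ_p)‖ = p⁻¹` for a natural number `n` with `ord_p n = 1`. [folklore] -/
theorem norm_natCast_eq_inv_of_padicValNat_eq_one {n : ℕ} [NeZero n] (hn : padicValNat p n = 1) :
    ‖(n : ℚ_[p])‖ = (p : ℝ)⁻¹ := by
  have hn0 : (n : ℚ_[p]) ≠ 0 := by exact_mod_cast (NeZero.ne n)
  rw [Padic.norm_eq_zpow_neg_valuation hn0, Padic.valuation_natCast, hn]
  simp

/-- **T-U3′ (the certificate).** Let `χ ≠ 1` be a Dirichlet character modulo `n` with values in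
`ℚ_p`, `ord_p n = 1`. Suppose `χ(j) ≡ c(j) · j^e (mod p²)` for all residues `j` (an
integer-valued `c` and an exponent `e`; for `χ = ω^a · θ` with `ω` the Teichmüller character and
`θ` `ℤ`-valued take `c = θ`, `e = pa`: `ω(j)^a ≡ j^{pa} (mod p²)`,
`KrizLi2019.IsTeichmullerCharacter.norm_pow_sub_pow_le`), and that the INTEGER
`S = Σ_{0 ≤ j < n} c(j) · j^{e+1}` satisfies `p ∣ S` and `p² ∤ S`. Then `B_{1,χ}` is a `p`-adic
unit: `‖B_{1,χ}‖_p = 1`. (Planner's form at `p = 7`: `S mod 49 ∈ {7, 14, …, 42}`.)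
[cite: KrizLi2019, §1.5 display (1) (p. 7) and §8 (35) (p. 52)] [cite: Washington1997, §5.1 and Thm. 4.2] -/
theorem norm_generalizedBernoulli_one_eq_one_of_cert {n : ℕ} [NeZero n]
    (χ : DirichletCharacter ℚ_[p] n) (hχ : χ ≠ 1) (hn : padicValNat p n = 1)
    (c : ZMod n → ℤ) (e : ℕ)
    (happrox : ∀ j : ZMod n,
      ‖χ j - (c j : ℚ_[p]) * (j.val : ℚ_[p]) ^ e‖ ≤ (p : ℝ) ^ (-2 : ℤ))
    (h1 : (p : ℤ) ∣ ∑ j : ZMod n, c j * (j.val : ℤ) ^ (e + 1))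
    (h2 : ¬ (p : ℤ) ^ 2 ∣ ∑ j : ZMod n, c j * (j.val : ℤ) ^ (e + 1)) :
    ‖generalizedBernoulli 1 χ‖ = 1 := by
  have hp : (p : ℝ)⁻¹ < 1 := inv_lt_one_of_one_lt₀ (by exact_mod_cast (Fact.out : p.Prime).one_lt)
  have hp0 : (0 : ℝ) < (p : ℝ)⁻¹ := inv_pos.mpr (by exact_mod_cast (Fact.out : p.Prime).pos)
  set S : ℤ := ∑ j : ZMod n, c j * (j.val : ℤ) ^ (e + 1) with hS
  set T : ℚ_[p] := ∑ j : ZMod n, χ j * (j.val : ℚ_[p]) with hT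
  -- `‖T − S‖ ≤ p⁻²`
  have hTS : ‖T - (S : ℚ_[p])‖ ≤ (p : ℝ) ^ (-2 : ℤ) := by
    have hdiff : T - (S : ℚ_[p]) =
        ∑ j : ZMod n, (χ j - (c j : ℚ_[p]) * (j.val : ℚ_[p]) ^ e) * (j.val : ℚ_[p]) := by
      rw [hT, hS]; push_cast
      rw [← Finset.sum_sub_distrib]
      exact Finset.sum_congr rfl fun j _ => by ring
    rw [hdiff]
    refine IsUltrametricDist.norm_sum_le_of_forall_le_of_nonneg (zpow_nonneg (Nat.cast_nonneg p) _)
      fun j _ => ?_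
    rw [norm_mul]
    calc ‖χ j - (c j : ℚ_[p]) * (j.val : ℚ_[p]) ^ e‖ * ‖(j.val : ℚ_[p])‖
        ≤ (p : ℝ) ^ (-2 : ℤ) * 1 :=
          mul_le_mul (happrox j) (by exact_mod_cast Padic.norm_int_le_one (j.val : ℤ)) (norm_nonneg _)
            (zpow_nonneg (Nat.cast_nonneg p) _)
      _ = (p : ℝ) ^ (-2 : ℤ) := mul_one _
  -- `‖S‖ = p⁻¹`, hence `‖T‖ = p⁻¹`
  have hSn : ‖(S : ℚ_[p])‖ = (p : ℝ)⁻¹ := norm_intCast_eq_inv_of_dvd_of_not_sq_dvd h1 h2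
  have hlt : ‖T - (S : ℚ_[p])‖ < ‖(S : ℚ_[p])‖ := by
    rw [hSn]
    refine lt_of_le_of_lt hTS ?_
    rw [show ((p : ℝ) ^ (-2 : ℤ)) = (p : ℝ)⁻¹ * (p : ℝ)⁻¹ by
      rw [zpow_neg, zpow_two, mul_inv]]
    exact mul_lt_of_lt_one_right hp0 hp
  have hTn : ‖T‖ = (p : ℝ)⁻¹ := by
    have hne : ‖T - (S : ℚ_[p])‖ ≠ ‖(S : ℚ_[p])‖ := hlt.ne
    have := Padic.add_eq_max_of_ne hne
    rw [sub_add_cancel, max_eq_right hlt.le, hSn] at this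
    exact this
  -- `B_{1,χ} = T / n`, `‖n‖ = p⁻¹`
  rw [generalizedBernoulli_one_eq_sum_div χ hχ, ← hT, norm_div, hTn,
    norm_natCast_eq_inv_of_padicValNat_eq_one hn]
  exact div_self hp0.ne'

/-- **T-U3′ for a PRIMITIVE character, in the fact's currency `bernoulliOnePrim`.** For `θ`
primitive of level `n` with `ord_p n = 1` (so `θ ≠ 1`), the mod-`p²` certificate of
`norm_generalizedBernoulli_one_eq_one_of_cert` gives `‖bernoulliOnePrim θ‖_p = 1`.
[cite: KrizLi2019, §1.5 display (1) (p. 7), Thm. 1.20 (p. 8)] -/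
theorem norm_bernoulliOnePrim_eq_one_of_cert {n : ℕ} [NeZero n]
    (θ : DirichletCharacter ℚ_[p] n) (hθ : θ.IsPrimitive) (hn : padicValNat p n = 1)
    (c : ZMod n → ℤ) (e : ℕ)
    (happrox : ∀ j : ZMod n,
      ‖θ j - (c j : ℚ_[p]) * (j.val : ℚ_[p]) ^ e‖ ≤ (p : ℝ) ^ (-2 : ℤ))
    (h1 : (p : ℤ) ∣ ∑ j : ZMod n, c j * (j.val : ℤ) ^ (e + 1))
    (h2 : ¬ (p : ℤ) ^ 2 ∣ ∑ j : ZMod n, c j * (j.val : ℤ) ^ (e + 1)) :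
    ‖bernoulliOnePrim θ‖ = 1 := by
  have hθ1 : θ ≠ 1 := by
    intro h
    have hc : θ.conductor = 1 := DirichletCharacter.eq_one_iff_conductor_eq_one.mp h
    rw [hθ] at hc
    rw [hc, padicValNat_one_right] at hn
    exact zero_ne_one hn
  rw [bernoulliOnePrim_eq_of_isPrimitive θ hθ]
  exact norm_generalizedBernoulli_one_eq_one_of_cert θ hθ1 hn c e happrox h1 h2

/-! ## §3 Assembling the fact's hypothesis `¬ ‖B₁ · B₂‖ ≤ p⁻¹` -/

/-- Two `p`-adic units have a unit product: `¬ ‖x · y‖ ≤ p⁻¹`. [folklore] -/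
theorem not_norm_mul_le_inv_of_norm_eq_one {x y : ℚ_[p]} (hx : ‖x‖ = 1) (hy : ‖y‖ = 1) :
    ¬ ‖x * y‖ ≤ (p : ℝ)⁻¹ := by
  rw [norm_mul, hx, hy, one_mul, not_le]
  exact inv_lt_one_of_one_lt₀ (by exact_mod_cast (Fact.out : p.Prime).one_lt)

/-- **T-U3′ assembled in the fact's currency.** If the two Bernoulli characters of Kriz–Li
Thm. 1.20 (any `χ₁` mod `n₁`, `χ₂` mod `n₂` — in the fact: `bernoulliCharOne ψ εK`,
`bernoulliCharTwo ψ εK ω`) are the lifts of PRIMITIVE characters `θ₁`, `θ₂` whose Bernoulli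
numbers are certified units (`‖B_{1,θᵢ}‖ = 1`, e.g. by `norm_generalizedBernoulli_one_eq_one_of_cert`),
then the hypothesis `¬ ‖bernoulliOnePrim χ₁ · bernoulliOnePrim χ₂‖ ≤ p⁻¹` of
`KrizLi2019.thm120_padicLogHeegner_unit_of_bernoulli` holds. [cite: KrizLi2019, Thm. 1.20 (p. 8, the Bernoulli hypothesis)] -/
theorem bernoulli_hypothesis_of_certs {m₁ n₁ m₂ n₂ : ℕ} [NeZero m₁] [NeZero n₁] [NeZero m₂]
    [NeZero n₂] (θ₁ : DirichletCharacter ℚ_[p] m₁) (hθ₁ : θ₁.IsPrimitive) (h₁ : m₁ ∣ n₁)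
    (θ₂ : DirichletCharacter ℚ_[p] m₂) (hθ₂ : θ₂.IsPrimitive) (h₂ : m₂ ∣ n₂)
    (χ₁ : DirichletCharacter ℚ_[p] n₁) (hχ₁ : χ₁ = DirichletCharacter.changeLevel h₁ θ₁)
    (χ₂ : DirichletCharacter ℚ_[p] n₂) (hχ₂ : χ₂ = DirichletCharacter.changeLevel h₂ θ₂)
    (hu₁ : ‖generalizedBernoulli 1 θ₁‖ = 1) (hu₂ : ‖generalizedBernoulli 1 θ₂‖ = 1) :
    ¬ ‖bernoulliOnePrim χ₁ * bernoulliOnePrim χ₂‖ ≤ (p : ℝ)⁻¹ := by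
  subst hχ₁ hχ₂
  rw [bernoulliOnePrim_changeLevel_eq θ₁ hθ₁ h₁, bernoulliOnePrim_changeLevel_eq θ₂ hθ₂ h₂]
  exact not_norm_mul_le_inv_of_norm_eq_one hu₁ hu₂

end Summit.BirchSwinnertonDyer.Rank1Residual.X12.O11.RouteU

end
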